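import Mathlib
import HarnessLib
import Literature.Probability.MarkovChains.PseudoMarginalVariance
import Literature.Probability.Distributions.ConvexOrderMartingaleCoupling

/-!
# Ordering two pseudo-marginal algorithms by a martingale coupling of their weights: the
# asymptotic-variance order (Andrieu–Vihola 2016, Theorem 10 (c)), and averaging more draws

HONEST FRAMING: exact (Metropolis-corrected) sampling algorithms for lattice gauge theory;
figures of merit are autocorrelation/cost numbers at stated couplings and volumes; no
continuum-physics claim.

Setting (finite form; the vocabulary of `PseudoMarginal.lean`, `PseudoMarginalAcceptance.lean`,
`PeskunOrdering.lean`, `PseudoMarginalVariance.lean`).  `X` finite with a positive probability vector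
`π`; `T ≥ 0` a proposal matrix with row sums `≤ 1`; TWO positive unbiased estimators of `π`,
`f₁ : X → Ξ₁ → ℝ` with noise law `g₁` and `f₂ : X → Ξ₂ → ℝ` with noise law `g₂`, i.e. two
pseudo-marginal approximations `P̃₁ = kernel T f₁ g₁`, `P̃₂ = kernel T f₂ g₂` "of `P` aiming to sample
from `π`, sharing a common family of marginal proposal probability distributions `{q(x, ·)}` but with
distinct weight distributions" [cite: AndrieuVihola2016, Theorem 10].  The printed hypothesis is the
convex order `{Q_x^{(1)}} ≤cx {Q_x^{(2)}}` of the normalised weights; the printed PROOF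
[cite: AndrieuVihola2016, §5 ("Proofs by a martingale coupling of pseudo-marginal kernels")] runs on
a MARTINGALE COUPLING of the two weight laws — "there exists a probability kernel `R_x` … (a) `R_x`
has marginals `Q_x^{(1)}` and `Q_x^{(2)}` … (b) `R_x` is the distribution of a martingale", i.e.
`E[V | W] = W` [cite: AndrieuVihola2016, §5 Lemma 18 and Remark 19] — whose existence is Strassen's
theorem ([cite: AndrieuVihola2016, §2 Theorem 7 (Strassen) and §5 Lemma 18], after Leskelä–Vihola).
Here the coupling is first the HYPOTHESIS (`PseudoMarginal.IsMartingaleCoupling`, finite form of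
(a)–(b)); it implies the convex order (`IsMartingaleCoupling.isCxLE`, the elementary half of
Strassen's theorem, by Jensen), and for the lattice application — averaging independent pseudofermion
draws — the coupling is written down explicitly (`looCoupling`, leave one draw out uniformly at
random).  The final section `Strassen` then feeds in Strassen's theorem itself in finite form (tree
`Literature.Probability.Distributions.exists_martingaleCoupling_of_convexOrder`), so that Theorem
10 (c) is also available under its PRINTED hypothesis, the convex order (`asympVar_lift_mono_of_isCxLE`).

Results (all proved, finite sums):

* `PseudoMarginal.dirichletForm_kernel_eq` — the Dirichlet form of the pseudo-marginal chain on an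
  ARBITRARY function of `(x, ξ)` in flow form,
  `𝓔_P̃(φ) = ½ Σ_{x,y} Σ_{ξ,ξ'} g ξ g ξ' min(f x ξ T x y, f y ξ' T y x) (φ(x,ξ) − φ(y,ξ'))²`
  [cite: AndrieuVihola2016, §3 (`𝓔_Π(f) = ½∫μ(dx)Π(x,dy)(f(x) − f(y))²`) and §1 (the kernel `P̃`)].
* `PseudoMarginal.IsMartingaleCoupling.isCxLE` — a martingale coupling of `Q¹` and `Q²` gives
  `Q¹ ≤cx Q²` [cite: AndrieuVihola2016, §2 (Definition 3; the sentence before Theorem 7: "It should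
  be clear by application of Jensen's inequality that if `W₁` and `W₂` are defined on the same
  probability space and `E[W₂ | W₁] = W₁`, then `W₁ ≤cx W₂`"), §5 Remark 19].
* `PseudoMarginal.piInner_lift_condAvg` — the conditional average `w(x,v) = E[h(x, W) | V = v]` of a
  function `h` of `(x, w)` has `⟨f̄, w⟩_{π̃₂} = ⟨f̄, h⟩_{π̃₁}` for observables `f` of the state (the
  marginal correspondences of [cite: AndrieuVihola2016, §5 Lemma 20 and Corollary 21]);
  `PseudoMarginal.dirichletForm_condAvg_le` — and `𝓔_{P̃₂}(w) ≤ 𝓔_{P̃₁}(h)` ("by the properties of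
  `R_x` and `R_y` and by Jensen's inequality … `min{w, r(x,y)u} ≥ ∫ min{v, r(x,y)t}`"
  [cite: AndrieuVihola2016, §5 Theorem 22 (b) and its proof]).
* **`PseudoMarginal.asympVar_lift_mono_of_coupling` — [cite: AndrieuVihola2016, Theorem 10 (c)]**
  (finite form, coupling hypothesis): "for any `f : X → ℝ` with `var_π(f) < ∞`, the asymptotic
  variances satisfy `var(f, P̃₁) ≤ var(f, P̃₂)`" — LESS NOISY weights (a martingale coarsening of the
  noisier ones) give the SMALLER asymptotic variance for every observable of the state and every
  proposal matrix; with the exact identity `asympVar_sub_asympVar_eq_of_coupling`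
  (`v₂ − v₁ = 2[𝓔₁(h₁) − 𝓔₂(w)] + 2𝓔₂(Z̃₂ f̄ − w)`, `h₁ = Z̃₁ f̄`, both brackets `≥ 0`).
* `PseudoMarginal.looCoupling_isMartingaleCoupling` — dropping one of `M + 2` i.i.d. draws uniformly
  at random is a martingale coupling of the `(M+2)`-draw average with the `(M+1)`-draw average
  (`W̄_{M+2} = (1/(M+2)) Σ_j W̄_{M+1}^{(−j)}`) [cite: AndrieuVihola2016, §6.1 Theorem 28 and
  Theorem 31 (exchangeable copies, uniform weights `u_{k+1} ≺ u_k`)]; hence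
  **`PseudoMarginal.asympVar_avgEst_succ_le`** — "every extra sample improves performance":
  `N ↦ var(f, P̃_{u_N})` is non-increasing [cite: AndrieuVihola2016, §6.1 Theorem 31 with Remark 15
  ("`i ↦ var(f, P̃_i)` is non-increasing")], the asymptotic-variance / integrated-autocorrelation
  analogue of the monotonicity of `ESS(N_pf)` in the number of pseudofermion draws
  [cite: AbbottEtAl2022Fermions, §III.E (`w_{N_pf}`, `ESS(N_pf)`)].
* (section `Strassen`) `PseudoMarginal.IsCxLE.exists_isMartingaleCoupling`,
  `PseudoMarginal.isCxLE_iff_exists_isMartingaleCoupling` — "`W₁ ≤cx W₂` if and only if there exists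
  a probability space with random variables `W̌₁` and `W̌₂` coinciding with `W₁` and `W₂` in
  distribution respectively, such that `(W̌₁, W̌₂)` is a martingale pair" [cite: AndrieuVihola2016, §2
  Theorem 7 (Strassen's theorem)], finite form, from the tree's
  `Literature.Probability.Distributions.exists_martingaleCoupling_of_convexOrder` ([cite: Strassen1965];
  proof by Farkas' lemma and the upper envelope of an affine family); hence
  **`PseudoMarginal.asympVar_lift_mono_of_isCxLE`** — Theorem 10 (c) under its PRINTED hypothesis
  `{Q_x^{(1)}} ≤cx {Q_x^{(2)}}` [cite: AndrieuVihola2016, Theorem 10 (c) with §5 Lemma 18 (the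
  coupling `R_x` exists for each `x`)].

PROOF ROUTE (and the deviation from print).  The printed proof of Theorem 10 (c)
[cite: AndrieuVihola2016, §5] builds from `R_x` an augmented space `X × ℝ₊²` with weight
`π̆ = π R_x(dw dv) v`, two `π̆`-reversible kernels `P̆₁`, `P̆₂` marginally equivalent to `P̃₁`, `P̃₂`
(Lemma 20, Corollary 21), proves `𝓔_{P̆₁}(g) ≥ 𝓔_{P̆₂}(g)` for `g` depending on `(x, w)` only by
Jensen (Theorem 22 (b)), and concludes by the Tierney-type variance comparison on the common space
(Theorem 17) along `λ ↑ 1`.  Finite rendering: the augmented chain is not needed — its two uses are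
(i) to transport the `P̃₁`-Poisson solution `h₁ = Z̃₁ f̄` to the space of `P̃₂`, which is done here
by the conditional average `w = condAvg r g₂ h₁` (`w(x, v) = E_{R_x}[h₁(x, W) | V = v]`, the kernel
`K₁` of the printed proof), with `⟨f̄, w⟩_{π̃₂} = ⟨f̄, h₁⟩_{π̃₁}` by the martingale property
(`piInner_lift_condAvg`); and (ii) the Dirichlet-form comparison Theorem 22 (b), which becomes
`𝓔_{P̃₂}(w) ≤ 𝓔_{P̃₁}(h₁)` (`dirichletForm_condAvg_le`: Jensen for the conditional average, then the
printed "`min{w, r u} ≥ ∫∫ min{v, r t}`" step).  The variance comparison is then the tree's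
Bellman / Caracciolo–Pelissetto–Sokal variational identity for `P̃₂` at the test function `w`
(`variational_identity`, [cite: AndrieuVihola2016, §4 Lemma 16]) at `λ = 1` (finite irreducible
chains): `⟨f̄, Z̃₂f̄⟩ ≥ 2⟨f̄, w⟩ − 𝓔₂(w) ≥ 2⟨f̄, h₁⟩ − 𝓔₁(h₁) = ⟨f̄, Z̃₁f̄⟩`.  The marginal case
`Q¹ ≡ δ_1` is `PseudoMarginalVariance.lean` ([cite: AndrieuVihola2015, Theorem 7]).

Deliberately NOT here: items (d)–(e) of Theorem 10 (spectral gaps); Theorem 22 (c) for functions of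
`(x, w)`; general state spaces and the measurable-coupling form of Strassen's theorem
([cite: AndrieuVihola2016, §5 Lemma 18] after Leskelä–Vihola — on a finite `X` the coupling is chosen
pointwise in `x`, no measurability is needed); infinite variances.  TODO(general form).

Context: cell pub-lqcd (venture LatticeQCDFlow), R2-SCOPE.md §3 E2 D2 / E6 (`N_pf` draws, `ESS(N_pf)`),
§4 C-PM: with `pmAccept_avgEst_mono` (every extra draw raises the acceptance) this file adds that
every extra draw lowers the integrated autocorrelation time of every gauge-field observable — the
cost side (`n_solve ∝ N_pf`, E7) being the other half of the trade-off.
-/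

namespace Literature.Probability.MarkovChains

open Finset Matrix

variable {X : Type*} [Fintype X] [DecidableEq X]

namespace PseudoMarginal

variable {Ξ : Type*} [Fintype Ξ] [DecidableEq Ξ]

/-! ## The pseudo-marginal Dirichlet form on arbitrary functions of `(x, ξ)` -/

omit [Fintype X] [DecidableEq X] [Fintype Ξ] [DecidableEq Ξ] in
/-- A diagonal term of a Dirichlet-form double sum vanishes (private helper). [folklore] -/
private theorem mul_sub_self_sq' (a b : ℝ) : a * (b - b) ^ 2 = 0 := by
  rw [sub_self, zero_pow two_ne_zero, mul_zero]

/-- One term of the Dirichlet form of the pseudo-marginal chain: for EVERY pair of extended states,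
`π̃(x,ξ) P̃((x,ξ),(y,ξ')) (φ(x,ξ) − φ(y,ξ'))² = g ξ g ξ' min(f x ξ T x y, f y ξ' T y x) (φ(x,ξ) − φ(y,ξ'))²`
(off the diagonal the kernel entry is the Hastings rate, `target_mul_mhRate`; on the diagonal both
sides vanish). [cite: AndrieuVihola2016, §1 (the kernel
`P̃(x,w; dy × du) := q(x,dy)Q_y(du) min{1, r(x,y)u/w} + δ_{x,w}(dy × du)ρ̃(x,w)`) and §3 (`𝓔_Π`)] -/
theorem target_mul_kernel_mul_sq {f : X → Ξ → ℝ} {g : Ξ → ℝ} (hf : ∀ x ξ, 0 < f x ξ)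
    (hg : ∀ ξ, 0 < g ξ) (T : X → X → ℝ) (φ : X × Ξ → ℝ) (x y : X) (ξ ξ' : Ξ) :
    target f g (x, ξ) * kernel T f g (x, ξ) (y, ξ') * (φ (x, ξ) - φ (y, ξ')) ^ 2 =
      g ξ * g ξ' * min (f x ξ * T x y) (f y ξ' * T y x) * (φ (x, ξ) - φ (y, ξ')) ^ 2 := by
  by_cases h : (y, ξ') = (x, ξ)
  · rw [h, mul_sub_self_sq', mul_sub_self_sq']
  · rw [show kernel T f g (x, ξ) (y, ξ') = mhRate (proposal T g) (target f g) (x, ξ) (y, ξ')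
      from mhKernel_of_ne h, target_mul_mhRate hf hg T x y ξ ξ']

/-- **The pseudo-marginal Dirichlet form in flow form, for an arbitrary function of `(x, ξ)`**:
`𝓔_P̃(φ) = ½ Σ_x Σ_y Σ_{(ξ,ξ')} g ξ g ξ' min(f x ξ T x y, f y ξ' T y x) (φ(x,ξ) − φ(y,ξ'))²`
(the noise pair summed as one index). [cite: AndrieuVihola2016, §3 (the identity
`𝓔_Π(f) = ⟨f,(I − Π)f⟩_μ = ½∫μ(dx)Π(x,dy)(f(x) − f(y))²`) with §1 (the kernel `P̃` and
`π̃(dx × dw) = π(dx)Q_x(dw)w`)] -/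
theorem dirichletForm_kernel_eq {f : X → Ξ → ℝ} {g : Ξ → ℝ} (hf : ∀ x ξ, 0 < f x ξ)
    (hg : ∀ ξ, 0 < g ξ) (T : X → X → ℝ) (φ : X × Ξ → ℝ) :
    dirichletForm (target f g) (kernel T f g) φ =
      (1 / 2) * ∑ x, ∑ y, ∑ q : Ξ × Ξ,
        g q.1 * g q.2 * min (f x q.1 * T x y) (f y q.2 * T y x) * (φ (x, q.1) - φ (y, q.2)) ^ 2 := by
  unfold dirichletForm
  congr 1
  calc ∑ z : X × Ξ, ∑ z' : X × Ξ,
        target f g z * (kernel T f g : Matrix (X × Ξ) (X × Ξ) ℝ) z z' * (φ z - φ z') ^ 2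
      = ∑ x, ∑ ξ, ∑ y, ∑ ξ',
          target f g (x, ξ) * kernel T f g (x, ξ) (y, ξ') * (φ (x, ξ) - φ (y, ξ')) ^ 2 := by
        rw [Fintype.sum_prod_type]
        refine sum_congr rfl fun x _ => sum_congr rfl fun ξ _ => ?_
        rw [Fintype.sum_prod_type]
    _ = ∑ x, ∑ y, ∑ ξ, ∑ ξ',
          g ξ * g ξ' * min (f x ξ * T x y) (f y ξ' * T y x) * (φ (x, ξ) - φ (y, ξ')) ^ 2 := by
        refine sum_congr rfl fun x _ => ?_
        rw [sum_comm]
        exact sum_congr rfl fun y _ => sum_congr rfl fun ξ _ => sum_congr rfl fun ξ' _ =>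
          target_mul_kernel_mul_sq hf hg T φ x y ξ ξ'
    _ = ∑ x, ∑ y, ∑ q : Ξ × Ξ,
          g q.1 * g q.2 * min (f x q.1 * T x y) (f y q.2 * T y x) * (φ (x, q.1) - φ (y, q.2)) ^ 2 := by
        refine sum_congr rfl fun x _ => sum_congr rfl fun y _ => ?_
        simp only [Fintype.sum_prod_type]

/-! ## Martingale couplings of two weight laws -/

section Coupling

variable {Ξ₁ Ξ₂ : Type*} [Fintype Ξ₁] [DecidableEq Ξ₁] [Fintype Ξ₂] [DecidableEq Ξ₂]

omit [Fintype X] [DecidableEq X] [Fintype Ξ] [DecidableEq Ξ] [DecidableEq Ξ₁] [DecidableEq Ξ₂] in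
/-- **A martingale coupling of two finitely supported weight laws** — values `w₁` with probabilities
`g₁` (the law `Q¹`) and values `w₂` with probabilities `g₂` (the law `Q²`): a joint law `r ξ₁ ξ₂ ≥ 0` on
`Ξ₁ × Ξ₂` whose marginals are `g₁` and `g₂` and under which the second value is a MARTINGALE step
from the first, `E[W₂ · 1{ξ₁}] = w₁ ξ₁ · P(ξ₁)`, i.e. `E[W₂ | W₁] = W₁` — "(a) `R_x` has marginals
`Q_x^{(1)}` and `Q_x^{(2)}` … (b) `R_x` is the distribution of a martingale, that is, for all `A`,
`∫ R_x(dw × dv) v 𝟙{w ∈ A} = ∫ R_x(dw × dv) w 𝟙{w ∈ A}`".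
[cite: AndrieuVihola2016, §5 Lemma 18 (a)–(b) and Remark 19 ("`E[V | W] = W` almost surely")] -/
structure IsMartingaleCoupling (g₁ : Ξ₁ → ℝ) (w₁ : Ξ₁ → ℝ) (g₂ : Ξ₂ → ℝ) (w₂ : Ξ₂ → ℝ)
    (r : Ξ₁ → Ξ₂ → ℝ) : Prop where
  /-- the joint law is non-negative -/
  nonneg : ∀ ξ₁ ξ₂, 0 ≤ r ξ₁ ξ₂
  /-- first marginal `Q¹` -/
  fst : ∀ ξ₁, ∑ ξ₂, r ξ₁ ξ₂ = g₁ ξ₁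
  /-- second marginal `Q²` -/
  snd : ∀ ξ₂, ∑ ξ₁, r ξ₁ ξ₂ = g₂ ξ₂
  /-- martingale property `E[W₂ ; W₁ = w₁ ξ₁] = w₁ ξ₁ · P(ξ₁)` -/
  mart : ∀ ξ₁, ∑ ξ₂, r ξ₁ ξ₂ * w₂ ξ₂ = g₁ ξ₁ * w₁ ξ₁

omit [Fintype X] [DecidableEq X] [Fintype Ξ] [DecidableEq Ξ] [DecidableEq Ξ₁] [DecidableEq Ξ₂] in
/-- **A martingale coupling forces the convex order** `Q¹ ≤cx Q²` (the elementary half of Strassen's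
theorem: for convex `φ`, `E φ(W₂) = E E[φ(W₂) | W₁] ≥ E φ(E[W₂ | W₁]) = E φ(W₁)` by Jensen) — "It
should be clear by application of Jensen's inequality that if `W₁` and `W₂` are defined on the same
probability space and `E[W₂ | W₁] = W₁`, then `W₁ ≤cx W₂`.  The following characterisation of the
convex order, often referred to as Strassen's theorem, establishes the converse".  So the hypothesis
used below is the printed one up to Strassen's existence theorem (Theorem 7; the converse is
`IsCxLE.exists_isMartingaleCoupling` in section `Strassen` at the end of this file).  Needs
`g₁ > 0` (the conditional laws `r ξ₁ · / g₁ ξ₁`). [cite: AndrieuVihola2016, §2 (Definition 3; the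
paragraph before Theorem 7); §5 Remark 19 ("`V = W + Δ` is 'noisier' than `W`")] -/
theorem IsMartingaleCoupling.isCxLE {g₁ : Ξ₁ → ℝ} {w₁ : Ξ₁ → ℝ} {g₂ : Ξ₂ → ℝ} {w₂ : Ξ₂ → ℝ}
    {r : Ξ₁ → Ξ₂ → ℝ} (h : IsMartingaleCoupling g₁ w₁ g₂ w₂ r) (hg₁ : ∀ ξ₁, 0 < g₁ ξ₁) :
    IsCxLE g₁ w₁ g₂ w₂ := by
  intro φ hφ
  -- Jensen under each conditional law `r ξ₁ · / g₁ ξ₁`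
  have hJ : ∀ ξ₁, g₁ ξ₁ * φ (w₁ ξ₁) ≤ ∑ ξ₂, r ξ₁ ξ₂ * φ (w₂ ξ₂) := by
    intro ξ₁
    have hg := hg₁ ξ₁
    have hk1 : ∑ ξ₂, r ξ₁ ξ₂ / g₁ ξ₁ = 1 := by
      rw [← sum_div, h.fst ξ₁, div_self hg.ne']
    have hmean : ∑ ξ₂, (r ξ₁ ξ₂ / g₁ ξ₁) * w₂ ξ₂ = w₁ ξ₁ := by
      simp_rw [div_mul_eq_mul_div, ← sum_div, h.mart ξ₁]
      field_simp
    have hj := hφ.map_sum_le (t := univ) (w := fun ξ₂ => r ξ₁ ξ₂ / g₁ ξ₁) (p := w₂)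
      (fun ξ₂ _ => div_nonneg (h.nonneg ξ₁ ξ₂) hg.le) hk1 (fun _ _ => Set.mem_univ _)
    simp only [smul_eq_mul] at hj
    rw [hmean] at hj
    have hj' := mul_le_mul_of_nonneg_left hj hg.le
    rw [mul_sum] at hj'
    refine hj'.trans (le_of_eq (sum_congr rfl fun ξ₂ _ => ?_))
    field_simp
  calc ∑ ξ₁, g₁ ξ₁ * φ (w₁ ξ₁) ≤ ∑ ξ₁, ∑ ξ₂, r ξ₁ ξ₂ * φ (w₂ ξ₂) := sum_le_sum fun ξ₁ _ => hJ ξ₁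
    _ = ∑ ξ₂, ∑ ξ₁, r ξ₁ ξ₂ * φ (w₂ ξ₂) := sum_comm
    _ = ∑ ξ₂, g₂ ξ₂ * φ (w₂ ξ₂) := sum_congr rfl fun ξ₂ _ => by rw [← sum_mul, h.snd ξ₂]

omit [Fintype X] [DecidableEq X] [Fintype Ξ] [DecidableEq Ξ] [DecidableEq Ξ₁] [DecidableEq Ξ₂] in
/-- Under a martingale coupling the first law is a probability vector if the second one is.
[cite: AndrieuVihola2016, §5 Lemma 18 (a) (common mass of the two marginals)] -/
theorem IsMartingaleCoupling.sum_fst_eq {g₁ : Ξ₁ → ℝ} {w₁ : Ξ₁ → ℝ} {g₂ : Ξ₂ → ℝ} {w₂ : Ξ₂ → ℝ}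
    {r : Ξ₁ → Ξ₂ → ℝ} (h : IsMartingaleCoupling g₁ w₁ g₂ w₂ r) : ∑ ξ₁, g₁ ξ₁ = ∑ ξ₂, g₂ ξ₂ := by
  calc ∑ ξ₁, g₁ ξ₁ = ∑ ξ₁, ∑ ξ₂, r ξ₁ ξ₂ := sum_congr rfl fun ξ₁ _ => (h.fst ξ₁).symm
    _ = ∑ ξ₂, ∑ ξ₁, r ξ₁ ξ₂ := sum_comm
    _ = ∑ ξ₂, g₂ ξ₂ := sum_congr rfl fun ξ₂ _ => h.snd ξ₂

omit [Fintype X] [DecidableEq X] [Fintype Ξ] [DecidableEq Ξ] [DecidableEq Ξ₁] [DecidableEq Ξ₂] in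
/-- Under a martingale coupling the two laws have the same mean (`E W₂ = E W₁`).
[cite: AndrieuVihola2016, §2 Remark 4 ("the convex order `W₁ ≤cx W₂` clearly implies
`E[W₁] = E[W₂]`")] -/
theorem IsMartingaleCoupling.sum_mul_eq {g₁ : Ξ₁ → ℝ} {w₁ : Ξ₁ → ℝ} {g₂ : Ξ₂ → ℝ} {w₂ : Ξ₂ → ℝ}
    {r : Ξ₁ → Ξ₂ → ℝ} (h : IsMartingaleCoupling g₁ w₁ g₂ w₂ r) :
    ∑ ξ₁, g₁ ξ₁ * w₁ ξ₁ = ∑ ξ₂, g₂ ξ₂ * w₂ ξ₂ := by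
  calc ∑ ξ₁, g₁ ξ₁ * w₁ ξ₁ = ∑ ξ₁, ∑ ξ₂, r ξ₁ ξ₂ * w₂ ξ₂ := sum_congr rfl fun ξ₁ _ => (h.mart ξ₁).symm
    _ = ∑ ξ₂, ∑ ξ₁, r ξ₁ ξ₂ * w₂ ξ₂ := sum_comm
    _ = ∑ ξ₂, g₂ ξ₂ * w₂ ξ₂ := sum_congr rfl fun ξ₂ _ => by rw [← sum_mul, h.snd ξ₂]

omit [Fintype X] [DecidableEq X] [Fintype Ξ] [DecidableEq Ξ] [DecidableEq Ξ₁] [DecidableEq Ξ₂] in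
/-- The martingale property for the UN-normalised estimators: if `r` couples the normalised weights
`f₁ x · / π x` and `f₂ x · / π x`, then `Σ_{ξ₂} r ξ₁ ξ₂ · f₂ x ξ₂ = g₁ ξ₁ · f₁ x ξ₁`.
[cite: AndrieuVihola2016, §5 Lemma 18 (b)] -/
theorem IsMartingaleCoupling.sum_mul_est {g₁ : Ξ₁ → ℝ} {g₂ : Ξ₂ → ℝ} {r : Ξ₁ → Ξ₂ → ℝ}
    {f₁ : X → Ξ₁ → ℝ} {f₂ : X → Ξ₂ → ℝ} {π : X → ℝ} {x : X} (hπ : 0 < π x)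
    (h : IsMartingaleCoupling g₁ (fun ξ => f₁ x ξ / π x) g₂ (fun ξ => f₂ x ξ / π x) r) (ξ₁ : Ξ₁) :
    ∑ ξ₂, r ξ₁ ξ₂ * f₂ x ξ₂ = g₁ ξ₁ * f₁ x ξ₁ := by
  have h1 := h.mart ξ₁
  simp only [mul_div_assoc', ← sum_div] at h1
  exact (div_left_inj' hπ.ne').mp h1

/-! ## The conditional average of a function of `(x, w)` given the noisier weight -/

omit [Fintype X] [DecidableEq X] [Fintype Ξ] [DecidableEq Ξ] [DecidableEq Ξ₁] [Fintype Ξ₂]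
  [DecidableEq Ξ₂] in
/-- The CONDITIONAL AVERAGE of a function `φ` of `(x, ξ₁)` given the noisier variable:
`condAvg r g₂ φ (x, ξ₂) = Σ_{ξ₁} r x ξ₁ ξ₂ φ(x, ξ₁) / g₂ ξ₂ = E_{R_x}[φ(x, W) | V = v]` — integration
against the conditional law `K₁(x, u; dw)` of the printed proof
(`R_x(dw × du) = Q_x^{(2)}(du) K₁(x, u; dw)`). [cite: AndrieuVihola2016, §5 (proof of Theorem 10:
the regular conditional distributions `K₁`, `K₂`)] -/
noncomputable def condAvg (r : X → Ξ₁ → Ξ₂ → ℝ) (g₂ : Ξ₂ → ℝ) (φ : X × Ξ₁ → ℝ) : X × Ξ₂ → ℝ :=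
  fun z => (∑ ξ₁, r z.1 ξ₁ z.2 * φ (z.1, ξ₁)) / g₂ z.2

omit [DecidableEq X] [Fintype Ξ] [DecidableEq Ξ] [DecidableEq Ξ₁] [DecidableEq Ξ₂] in
/-- **Marginal correspondence of the transported function** (the finite face of Corollary 21 for the
pair `P̃₁`, `P̃₂`): for an observable `v` of the state and any function `φ` of `(x, ξ₁)`,
`⟨ṽ, condAvg r g₂ φ⟩_{π̃₂} = ⟨ṽ, φ⟩_{π̃₁}` — by the martingale property
`Σ_{ξ₂} r x ξ₁ ξ₂ f₂ x ξ₂ = g₁ ξ₁ f₁ x ξ₁`. [cite: AndrieuVihola2016, §5 Lemma 20 and Corollary 21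
(`π̆(g₁) = π̃₁(f₁)`, `π̆(g₂) = π̃₂(f₂)`)] -/
theorem piInner_lift_condAvg {f₁ : X → Ξ₁ → ℝ} {g₁ : Ξ₁ → ℝ} {f₂ : X → Ξ₂ → ℝ} {g₂ : Ξ₂ → ℝ}
    {r : X → Ξ₁ → Ξ₂ → ℝ} (hg₂ : ∀ ξ, 0 < g₂ ξ)
    (hmart : ∀ x ξ₁, ∑ ξ₂, r x ξ₁ ξ₂ * f₂ x ξ₂ = g₁ ξ₁ * f₁ x ξ₁) (v : X → ℝ) (φ : X × Ξ₁ → ℝ) :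
    piInner (target f₂ g₂) (lift v : X × Ξ₂ → ℝ) (condAvg r g₂ φ) =
      piInner (target f₁ g₁) (lift v : X × Ξ₁ → ℝ) φ := by
  unfold piInner
  rw [Fintype.sum_prod_type, Fintype.sum_prod_type]
  refine sum_congr rfl fun x _ => ?_
  calc ∑ ξ₂, target f₂ g₂ (x, ξ₂) * ((lift v : X × Ξ₂ → ℝ) (x, ξ₂) * condAvg r g₂ φ (x, ξ₂))
      = ∑ ξ₂, ∑ ξ₁, v x * φ (x, ξ₁) * (r x ξ₁ ξ₂ * f₂ x ξ₂) := by
        refine sum_congr rfl fun ξ₂ _ => ?_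
        have hg : g₂ ξ₂ ≠ 0 := (hg₂ ξ₂).ne'
        have e : target f₂ g₂ (x, ξ₂) * ((lift v : X × Ξ₂ → ℝ) (x, ξ₂) * condAvg r g₂ φ (x, ξ₂)) =
            v x * f₂ x ξ₂ * ∑ ξ₁, r x ξ₁ ξ₂ * φ (x, ξ₁) := by
          show g₂ ξ₂ * f₂ x ξ₂ * (v x * ((∑ ξ₁, r x ξ₁ ξ₂ * φ (x, ξ₁)) / g₂ ξ₂)) = _
          rw [show g₂ ξ₂ * f₂ x ξ₂ * (v x * ((∑ ξ₁, r x ξ₁ ξ₂ * φ (x, ξ₁)) / g₂ ξ₂))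
              = g₂ ξ₂ * (∑ ξ₁, r x ξ₁ ξ₂ * φ (x, ξ₁)) / g₂ ξ₂ * (v x * f₂ x ξ₂) by ring,
            mul_div_cancel_left₀ _ hg]
          ring
        rw [e, mul_sum]
        exact sum_congr rfl fun ξ₁ _ => by ring
    _ = ∑ ξ₁, ∑ ξ₂, v x * φ (x, ξ₁) * (r x ξ₁ ξ₂ * f₂ x ξ₂) := sum_comm
    _ = ∑ ξ₁, v x * φ (x, ξ₁) * (g₁ ξ₁ * f₁ x ξ₁) := by
        refine sum_congr rfl fun ξ₁ _ => ?_
        rw [← mul_sum, hmart x ξ₁]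
    _ = ∑ ξ₁, target f₁ g₁ (x, ξ₁) * ((lift v : X × Ξ₁ → ℝ) (x, ξ₁) * φ (x, ξ₁)) :=
        sum_congr rfl fun ξ₁ _ => by simp only [target, lift_apply]; ring

/-! ## Jensen for the conditional average, and Theorem 22 (b): `𝓔₂(w) ≤ 𝓔₁(h)` -/

omit [Fintype X] [DecidableEq X] [Fintype Ξ] [DecidableEq Ξ] [Fintype Ξ₁] [DecidableEq Ξ₁]
  [Fintype Ξ₂] [DecidableEq Ξ₂] in
/-- JENSEN for a finitely supported probability vector and the square: `(Σ p d)² ≤ Σ p d²`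
(`Σ p (d − m)² = Σ p d² − m² ≥ 0` with `m = Σ p d`; private helper). [folklore] -/
private theorem sq_wsum_le {ι : Type*} [Fintype ι] (p d : ι → ℝ) (hp : ∀ i, 0 ≤ p i)
    (hp1 : ∑ i, p i = 1) : (∑ i, p i * d i) ^ 2 ≤ ∑ i, p i * d i ^ 2 := by
  set m := ∑ i, p i * d i with hm
  have hvar : ∑ i, p i * (d i - m) ^ 2 = ∑ i, p i * d i ^ 2 - m ^ 2 := by
    have hterm : ∀ i, p i * (d i - m) ^ 2 = p i * d i ^ 2 - 2 * m * (p i * d i) + m ^ 2 * p i := by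
      intro i; ring
    simp_rw [hterm, sum_add_distrib, sum_sub_distrib, ← mul_sum, hp1, ← hm]
    ring
  have hnn : 0 ≤ ∑ i, p i * (d i - m) ^ 2 := sum_nonneg fun i _ => mul_nonneg (hp i) (sq_nonneg _)
  linarith

omit [Fintype X] [DecidableEq X] [Fintype Ξ] [DecidableEq Ξ] [DecidableEq Ξ₁] [DecidableEq Ξ₂] in
/-- A `p ⊗ q`-average of a quantity depending on the first variable only (private helper).
[folklore] -/
private theorem sum_sum_mul_mul_left {p : Ξ₁ → ℝ} {q : Ξ₂ → ℝ} (hq1 : ∑ b, q b = 1) (a : Ξ₁ → ℝ) :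
    ∑ i, ∑ j, p i * q j * a i = ∑ i, p i * a i := by
  refine sum_congr rfl fun i _ => ?_
  have : ∀ j, p i * q j * a i = p i * a i * q j := fun j => by ring
  simp_rw [this, ← mul_sum, hq1, mul_one]

omit [Fintype X] [DecidableEq X] [Fintype Ξ] [DecidableEq Ξ] [DecidableEq Ξ₁] [DecidableEq Ξ₂] in
/-- A `p ⊗ q`-average of a quantity depending on the second variable only (private helper).
[folklore] -/
private theorem sum_sum_mul_mul_right {p : Ξ₁ → ℝ} {q : Ξ₂ → ℝ} (hp1 : ∑ i, p i = 1) (b : Ξ₂ → ℝ) :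
    ∑ i, ∑ j, p i * q j * b j = ∑ j, q j * b j := by
  rw [sum_comm]
  refine sum_congr rfl fun j _ => ?_
  have : ∀ i, p i * q j * b j = q j * b j * p i := fun i => by ring
  simp_rw [this, ← mul_sum, hp1, mul_one]

omit [Fintype X] [DecidableEq X] [Fintype Ξ] [DecidableEq Ξ] [DecidableEq Ξ₁] [DecidableEq Ξ₂] in
/-- **Jensen for a difference of two independent conditional averages**: for probability vectors
`p` on `Ξ₁` and `q` on `Ξ₁'`, `(Σ p a − Σ q b)² ≤ Σ_{i,j} p i q j (a i − b j)²` — the step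
"`(E[h(x,W) − h(y,U) | v, t])² ≤ E[(h(x,W) − h(y,U))² | v, t]`" (private helper). [folklore] -/
private theorem sq_sub_wsum_le {Ξ₁' : Type*} [Fintype Ξ₁'] {p : Ξ₁ → ℝ} {q : Ξ₁' → ℝ}
    (hp : ∀ i, 0 ≤ p i) (hp1 : ∑ i, p i = 1) (hq : ∀ j, 0 ≤ q j) (hq1 : ∑ j, q j = 1)
    (a : Ξ₁ → ℝ) (b : Ξ₁' → ℝ) :
    (∑ i, p i * a i - ∑ j, q j * b j) ^ 2 ≤ ∑ ij : Ξ₁ × Ξ₁', p ij.1 * q ij.2 * (a ij.1 - b ij.2) ^ 2 := by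
  have hdiff : ∑ i, p i * a i - ∑ j, q j * b j = ∑ ij : Ξ₁ × Ξ₁', p ij.1 * q ij.2 * (a ij.1 - b ij.2) := by
    simp only [Fintype.sum_prod_type]
    simp_rw [mul_sub, sum_sub_distrib]
    rw [sum_sum_mul_mul_left hq1, sum_sum_mul_mul_right hp1]
  rw [hdiff]
  have h1 : ∑ ij : Ξ₁ × Ξ₁', p ij.1 * q ij.2 = 1 := by
    simp only [Fintype.sum_prod_type]
    rw [← sum_mul_sum, hp1, hq1, mul_one]
  exact sq_wsum_le (fun ij : Ξ₁ × Ξ₁' => p ij.1 * q ij.2) (fun ij => a ij.1 - b ij.2)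
    (fun ij => mul_nonneg (hp ij.1) (hq ij.2)) h1

omit [Fintype X] [DecidableEq X] [Fintype Ξ] [DecidableEq Ξ] [DecidableEq Ξ₁] [Fintype Ξ₂]
  [DecidableEq Ξ₂] in
/-- Jensen for the transported function: for every pair of extended states of the noisier chain,
`(w(x,ξ₂) − w(y,ξ₂'))² ≤ Σ_{(ξ₁,ξ₁')} (r x ξ₁ ξ₂/g₂ ξ₂)(r y ξ₁' ξ₂'/g₂ ξ₂') (φ(x,ξ₁) − φ(y,ξ₁'))²` with
`w = condAvg r g₂ φ` — "by the properties of `R_x` and `R_y` and by Jensen's inequality".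
[cite: AndrieuVihola2016, §5 (proof of Theorem 22 (a)–(b))] -/
theorem sq_condAvg_sub_le {g₂ : Ξ₂ → ℝ} {r : X → Ξ₁ → Ξ₂ → ℝ}
    (hr : ∀ x ξ₁ ξ₂, 0 ≤ r x ξ₁ ξ₂) (hr₂ : ∀ x ξ₂, ∑ ξ₁, r x ξ₁ ξ₂ = g₂ ξ₂) (hg₂ : ∀ ξ, 0 < g₂ ξ)
    (φ : X × Ξ₁ → ℝ) (x y : X) (ξ₂ ξ₂' : Ξ₂) :
    (condAvg r g₂ φ (x, ξ₂) - condAvg r g₂ φ (y, ξ₂')) ^ 2 ≤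
      ∑ p : Ξ₁ × Ξ₁, (r x p.1 ξ₂ / g₂ ξ₂) * (r y p.2 ξ₂' / g₂ ξ₂') * (φ (x, p.1) - φ (y, p.2)) ^ 2 := by
  have hk : ∀ (z : X) (ζ : Ξ₂), ∑ ξ₁, r z ξ₁ ζ / g₂ ζ = 1 := fun z ζ => by
    rw [← sum_div, hr₂ z ζ, div_self (hg₂ ζ).ne']
  have e : ∀ (z : X) (ζ : Ξ₂), condAvg r g₂ φ (z, ζ) = ∑ ξ₁, (r z ξ₁ ζ / g₂ ζ) * φ (z, ξ₁) := by
    intro z ζ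
    simp only [condAvg, sum_div]
    exact sum_congr rfl fun ξ₁ _ => by ring
  rw [e, e]
  exact sq_sub_wsum_le (fun ξ₁ => div_nonneg (hr x ξ₁ ξ₂) (hg₂ ξ₂).le) (hk x ξ₂)
    (fun ξ₁ => div_nonneg (hr y ξ₁ ξ₂') (hg₂ ξ₂').le) (hk y ξ₂') (fun ξ₁ => φ (x, ξ₁))
    (fun ξ₁ => φ (y, ξ₁))

omit [Fintype X] [DecidableEq X] [Fintype Ξ] [DecidableEq Ξ] [Fintype Ξ₁] [DecidableEq Ξ₁]
  [DecidableEq Ξ₂] in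
/-- The printed minimum step, summed: for fixed states `x, y` and first-law noises `ξ₁, ξ₁'`,
`Σ_{(ξ₂,ξ₂')} r x ξ₁ ξ₂ · r y ξ₁' ξ₂' · min(f₂ x ξ₂ T x y, f₂ y ξ₂' T y x)
≤ g₁ ξ₁ g₁ ξ₁' min(f₁ x ξ₁ T x y, f₁ y ξ₁' T y x)` — "`∫ R_x(dw × dv) R_y(du × dt) min{v, r(x,y)t} h
≤ ∫ … min{w, r(x,y)u} h`" (a sum of minima is at most the minimum of the sums; the sums are the
martingale property at `x` and the marginal at `y`, and vice versa).
[cite: AndrieuVihola2016, §5 (proof of Theorem 22 (a)–(b), the display with `min{w, r(x,y)u}`)] -/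
theorem sum_coupling_min_le {f₁ : X → Ξ₁ → ℝ} {g₁ : Ξ₁ → ℝ} {f₂ : X → Ξ₂ → ℝ}
    {r : X → Ξ₁ → Ξ₂ → ℝ} (hr : ∀ x ξ₁ ξ₂, 0 ≤ r x ξ₁ ξ₂) (hr₁ : ∀ x ξ₁, ∑ ξ₂, r x ξ₁ ξ₂ = g₁ ξ₁)
    (hmart : ∀ x ξ₁, ∑ ξ₂, r x ξ₁ ξ₂ * f₂ x ξ₂ = g₁ ξ₁ * f₁ x ξ₁) (hg₁ : ∀ ξ, 0 < g₁ ξ)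
    (T : X → X → ℝ) (x y : X) (ξ₁ ξ₁' : Ξ₁) :
    ∑ q : Ξ₂ × Ξ₂, r x ξ₁ q.1 * r y ξ₁' q.2 * min (f₂ x q.1 * T x y) (f₂ y q.2 * T y x) ≤
      g₁ ξ₁ * g₁ ξ₁' * min (f₁ x ξ₁ * T x y) (f₁ y ξ₁' * T y x) := by
  have hrr : ∀ q : Ξ₂ × Ξ₂, 0 ≤ r x ξ₁ q.1 * r y ξ₁' q.2 := fun q => mul_nonneg (hr _ _ _) (hr _ _ _)
  rw [mul_min_of_nonneg _ _ (mul_nonneg (hg₁ ξ₁).le (hg₁ ξ₁').le)]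
  refine le_min ?_ ?_
  · calc ∑ q : Ξ₂ × Ξ₂, r x ξ₁ q.1 * r y ξ₁' q.2 * min (f₂ x q.1 * T x y) (f₂ y q.2 * T y x)
        ≤ ∑ q : Ξ₂ × Ξ₂, r x ξ₁ q.1 * r y ξ₁' q.2 * (f₂ x q.1 * T x y) :=
          sum_le_sum fun q _ => mul_le_mul_of_nonneg_left (min_le_left _ _) (hrr q)
      _ = (∑ ξ₂, r x ξ₁ ξ₂ * f₂ x ξ₂) * T x y * ∑ ξ₂', r y ξ₁' ξ₂' := by
          simp only [Fintype.sum_prod_type]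
          rw [sum_mul, sum_mul]
          refine sum_congr rfl fun ξ₂ _ => ?_
          rw [mul_sum]
          exact sum_congr rfl fun ξ₂' _ => by ring
      _ = g₁ ξ₁ * g₁ ξ₁' * (f₁ x ξ₁ * T x y) := by rw [hmart x ξ₁, hr₁ y ξ₁']; ring
  · calc ∑ q : Ξ₂ × Ξ₂, r x ξ₁ q.1 * r y ξ₁' q.2 * min (f₂ x q.1 * T x y) (f₂ y q.2 * T y x)
        ≤ ∑ q : Ξ₂ × Ξ₂, r x ξ₁ q.1 * r y ξ₁' q.2 * (f₂ y q.2 * T y x) :=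
          sum_le_sum fun q _ => mul_le_mul_of_nonneg_left (min_le_right _ _) (hrr q)
      _ = (∑ ξ₂, r x ξ₁ ξ₂) * ((∑ ξ₂', r y ξ₁' ξ₂' * f₂ y ξ₂') * T y x) := by
          simp only [Fintype.sum_prod_type]
          rw [sum_mul]
          refine sum_congr rfl fun ξ₂ _ => ?_
          rw [sum_mul, mul_sum]
          exact sum_congr rfl fun ξ₂' _ => by ring
      _ = g₁ ξ₁ * g₁ ξ₁' * (f₁ y ξ₁' * T y x) := by rw [hmart y ξ₁', hr₁ x ξ₁]; ring

/-- **Theorem 22 (b), finite form — the transported function has the smaller Dirichlet form**: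
for a martingale coupling `r x` of the normalised weights at every state, and any function `φ` of
`(x, ξ₁)`, `𝓔_{P̃₂}(condAvg r g₂ φ) ≤ 𝓔_{P̃₁}(φ)` — "(b) `𝓔_{P̆₁}(g) ≥ 𝓔_{P̆₂}(g)` for any `g`"
depending on `(x, w)` only, read through the marginal correspondences of Corollary 21.  Proof as
printed: Jensen (`sq_condAvg_sub_le`), then the pointwise minimum step (`sum_coupling_min_le`).
[cite: AndrieuVihola2016, §5 Theorem 22 (b) and its proof] -/
theorem dirichletForm_condAvg_le {f₁ : X → Ξ₁ → ℝ} {g₁ : Ξ₁ → ℝ} {f₂ : X → Ξ₂ → ℝ} {g₂ : Ξ₂ → ℝ}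
    {π : X → ℝ} {r : X → Ξ₁ → Ξ₂ → ℝ} (hf₁ : ∀ x ξ, 0 < f₁ x ξ) (hg₁ : ∀ ξ, 0 < g₁ ξ)
    (hf₂ : ∀ x ξ, 0 < f₂ x ξ) (hg₂ : ∀ ξ, 0 < g₂ ξ) (hπ : ∀ x, 0 < π x)
    (hR : ∀ x, IsMartingaleCoupling g₁ (fun ξ => f₁ x ξ / π x) g₂ (fun ξ => f₂ x ξ / π x) (r x))
    (T : X → X → ℝ) (hT : ∀ x y, 0 ≤ T x y) (φ : X × Ξ₁ → ℝ) :
    dirichletForm (target f₂ g₂) (kernel T f₂ g₂) (condAvg r g₂ φ) ≤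
      dirichletForm (target f₁ g₁) (kernel T f₁ g₁) φ := by
  have hr : ∀ x ξ₁ ξ₂, 0 ≤ r x ξ₁ ξ₂ := fun x => (hR x).nonneg
  have hr₁ : ∀ x ξ₁, ∑ ξ₂, r x ξ₁ ξ₂ = g₁ ξ₁ := fun x => (hR x).fst
  have hr₂ : ∀ x ξ₂, ∑ ξ₁, r x ξ₁ ξ₂ = g₂ ξ₂ := fun x => (hR x).snd
  have hmart : ∀ x ξ₁, ∑ ξ₂, r x ξ₁ ξ₂ * f₂ x ξ₂ = g₁ ξ₁ * f₁ x ξ₁ :=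
    fun x ξ₁ => IsMartingaleCoupling.sum_mul_est (hπ x) (hR x) ξ₁
  rw [dirichletForm_kernel_eq hf₂ hg₂, dirichletForm_kernel_eq hf₁ hg₁]
  refine mul_le_mul_of_nonneg_left (sum_le_sum fun x _ => sum_le_sum fun y _ => ?_) (by norm_num)
  -- fixed pair of states `x, y`
  set w := condAvg r g₂ φ with hw
  have hP : ∀ q : Ξ₂ × Ξ₂, 0 ≤ g₂ q.1 * g₂ q.2 * min (f₂ x q.1 * T x y) (f₂ y q.2 * T y x) :=
    fun q => mul_nonneg (mul_nonneg (hg₂ _).le (hg₂ _).le)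
      (le_min (mul_nonneg (hf₂ _ _).le (hT x y)) (mul_nonneg (hf₂ _ _).le (hT y x)))
  calc ∑ q : Ξ₂ × Ξ₂, g₂ q.1 * g₂ q.2 * min (f₂ x q.1 * T x y) (f₂ y q.2 * T y x) *
          (w (x, q.1) - w (y, q.2)) ^ 2
      ≤ ∑ q : Ξ₂ × Ξ₂, g₂ q.1 * g₂ q.2 * min (f₂ x q.1 * T x y) (f₂ y q.2 * T y x) *
          ∑ p : Ξ₁ × Ξ₁, (r x p.1 q.1 / g₂ q.1) * (r y p.2 q.2 / g₂ q.2) *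
            (φ (x, p.1) - φ (y, p.2)) ^ 2 :=
        sum_le_sum fun q _ => mul_le_mul_of_nonneg_left
          (by rw [hw]; exact sq_condAvg_sub_le hr hr₂ hg₂ φ x y q.1 q.2) (hP q)
    _ = ∑ q : Ξ₂ × Ξ₂, ∑ p : Ξ₁ × Ξ₁,
          r x p.1 q.1 * r y p.2 q.2 * min (f₂ x q.1 * T x y) (f₂ y q.2 * T y x) *
            (φ (x, p.1) - φ (y, p.2)) ^ 2 := by
        refine sum_congr rfl fun q _ => ?_
        rw [mul_sum]
        refine sum_congr rfl fun p _ => ?_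
        have h1 : g₂ q.1 ≠ 0 := (hg₂ q.1).ne'
        have h2 : g₂ q.2 ≠ 0 := (hg₂ q.2).ne'
        have e : g₂ q.1 * g₂ q.2 * (r x p.1 q.1 / g₂ q.1 * (r y p.2 q.2 / g₂ q.2)) =
            r x p.1 q.1 * r y p.2 q.2 := by
          rw [div_mul_div_comm, mul_div_assoc', mul_div_cancel_left₀ _ (mul_ne_zero h1 h2)]
        calc g₂ q.1 * g₂ q.2 * min (f₂ x q.1 * T x y) (f₂ y q.2 * T y x) *
              (r x p.1 q.1 / g₂ q.1 * (r y p.2 q.2 / g₂ q.2) * (φ (x, p.1) - φ (y, p.2)) ^ 2)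
            = g₂ q.1 * g₂ q.2 * (r x p.1 q.1 / g₂ q.1 * (r y p.2 q.2 / g₂ q.2)) *
                min (f₂ x q.1 * T x y) (f₂ y q.2 * T y x) * (φ (x, p.1) - φ (y, p.2)) ^ 2 := by
              ring
          _ = r x p.1 q.1 * r y p.2 q.2 * min (f₂ x q.1 * T x y) (f₂ y q.2 * T y x) *
                (φ (x, p.1) - φ (y, p.2)) ^ 2 := by rw [e]
    _ = ∑ p : Ξ₁ × Ξ₁, (∑ q : Ξ₂ × Ξ₂,
          r x p.1 q.1 * r y p.2 q.2 * min (f₂ x q.1 * T x y) (f₂ y q.2 * T y x)) *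
            (φ (x, p.1) - φ (y, p.2)) ^ 2 := by
        rw [sum_comm]
        exact sum_congr rfl fun p _ => by rw [sum_mul]
    _ ≤ ∑ p : Ξ₁ × Ξ₁, g₁ p.1 * g₁ p.2 * min (f₁ x p.1 * T x y) (f₁ y p.2 * T y x) *
          (φ (x, p.1) - φ (y, p.2)) ^ 2 :=
        sum_le_sum fun p _ => mul_le_mul_of_nonneg_right
          (sum_coupling_min_le hr hr₁ hmart hg₁ T x y p.1 p.2) (sq_nonneg _)

/-! ## Theorem 10 (c): the asymptotic-variance order -/

omit [Fintype X] [DecidableEq X] [Fintype Ξ] [DecidableEq Ξ] [Fintype Ξ₁] [DecidableEq Ξ₁]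
  [Fintype Ξ₂] [DecidableEq Ξ₂] in
/-- The extended weight is positive (private helper). [folklore] -/
private theorem target_pos₂ {f₂ : X → Ξ₂ → ℝ} {g₂ : Ξ₂ → ℝ} (hf₂ : ∀ x ξ, 0 < f₂ x ξ)
    (hg₂ : ∀ ξ, 0 < g₂ ξ) (z : X × Ξ₂) : 0 < target f₂ g₂ z :=
  mul_pos (hg₂ z.2) (hf₂ z.1 z.2)

/-- **The exact identity behind Theorem 10 (c)** (finite form, `λ = 1`): with `ū = centred π u`,
`h₁ = Z̃₁ (lift ū)` the centred Poisson solution of the LESS noisy chain and `w = condAvg r g₂ h₁` its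
transport to the noisier chain,
`v(ũ, π̃₂, P̃₂) − v(ũ, π̃₁, P̃₁) = 2[𝓔_{P̃₁}(h₁) − 𝓔_{P̃₂}(w)] + 2 𝓔_{P̃₂}(Z̃₂ (lift ū) − w)` —
the variational identity of `P̃₂` at the test function `w` together with `⟨f̄, w⟩₂ = ⟨f̄, h₁⟩₁`
(`piInner_lift_condAvg`) and `𝓔₁(h₁) = ⟨f̄, h₁⟩₁`; both brackets are non-negative
(`dirichletForm_condAvg_le`, `dirichletForm_nonneg`).  This is the finite face of
"`0 ≤ 2λ[𝓔_{P̆₁}(f̂₁^λ) − 𝓔_{P̆₂}(f̂₁^λ)] ≤ var(f, λP̆₂) − var(f, λP̆₁)`".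
[cite: AndrieuVihola2016, §5 (proof of Theorem 22 (c)) with §4 Lemma 16 / Theorem 17] -/
theorem asympVar_sub_asympVar_eq_of_coupling {f₁ : X → Ξ₁ → ℝ} {g₁ : Ξ₁ → ℝ}
    {f₂ : X → Ξ₂ → ℝ} {g₂ : Ξ₂ → ℝ} {π : X → ℝ} {T : X → X → ℝ} {r : X → Ξ₁ → Ξ₂ → ℝ}
    (hf₁ : ∀ x ξ, 0 < f₁ x ξ) (hg₁ : ∀ ξ, 0 < g₁ ξ) (hg₁1 : ∑ ξ, g₁ ξ = 1)
    (hunb₁ : ∀ x, ∑ ξ, g₁ ξ * f₁ x ξ = π x)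
    (hf₂ : ∀ x ξ, 0 < f₂ x ξ) (hg₂ : ∀ ξ, 0 < g₂ ξ) (hg₂1 : ∑ ξ, g₂ ξ = 1)
    (hunb₂ : ∀ x, ∑ ξ, g₂ ξ * f₂ x ξ = π x) (hπ : ∀ x, 0 < π x) (hπ1 : ∑ x, π x = 1)
    (hT : ∀ x y, 0 ≤ T x y) (hTrow : ∀ x, ∑ y, T x y ≤ 1)
    (hR : ∀ x, IsMartingaleCoupling g₁ (fun ξ => f₁ x ξ / π x) g₂ (fun ξ => f₂ x ξ / π x) (r x))
    (hirr₁ : IsIrreducible (kernel T f₁ g₁ : Matrix (X × Ξ₁) (X × Ξ₁) ℝ))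
    (hirr₂ : IsIrreducible (kernel T f₂ g₂ : Matrix (X × Ξ₂) (X × Ξ₂) ℝ)) (u : X → ℝ) :
    asympVar (lift u : X × Ξ₂ → ℝ) (target f₂ g₂) (kernel T f₂ g₂)
        - asympVar (lift u : X × Ξ₁ → ℝ) (target f₁ g₁) (kernel T f₁ g₁) =
      2 * (dirichletForm (target f₁ g₁) (kernel T f₁ g₁)
              (fundamentalMatrix (target f₁ g₁) (kernel T f₁ g₁) *ᵥ (lift (centred π u) : X × Ξ₁ → ℝ))
          - dirichletForm (target f₂ g₂) (kernel T f₂ g₂)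
              (condAvg r g₂ (fundamentalMatrix (target f₁ g₁) (kernel T f₁ g₁) *ᵥ
                (lift (centred π u) : X × Ξ₁ → ℝ))))
      + 2 * dirichletForm (target f₂ g₂) (kernel T f₂ g₂)
          (fundamentalMatrix (target f₂ g₂) (kernel T f₂ g₂) *ᵥ (lift (centred π u) : X × Ξ₂ → ℝ)
            - condAvg r g₂ (fundamentalMatrix (target f₁ g₁) (kernel T f₁ g₁) *ᵥ
                (lift (centred π u) : X × Ξ₁ → ℝ))) := by
  -- standing facts, chain 1 (less noisy) and chain 2 (noisier)
  have hK₁row : IsRowStochastic (kernel T f₁ g₁) := kernel_isRowStochastic hf₁ hg₁ hg₁1 hT hTrow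
  have hDB₁ : DetailedBalance (target f₁ g₁) (kernel T f₁ g₁) := kernel_detailedBalance hf₁ hg₁ T
  have hst₁ : IsStationary (target f₁ g₁) (kernel T f₁ g₁) := hDB₁.isStationary hK₁row.2
  have hπ₁1 : ∑ z : X × Ξ₁, target f₁ g₁ z = 1 := by rw [sum_target_univ hunb₁, hπ1]
  have hZ₁ := isUnit_fundamentalInv hπ₁1 hK₁row hst₁ hirr₁
  have hK₂row : IsRowStochastic (kernel T f₂ g₂) := kernel_isRowStochastic hf₂ hg₂ hg₂1 hT hTrow
  have hDB₂ : DetailedBalance (target f₂ g₂) (kernel T f₂ g₂) := kernel_detailedBalance hf₂ hg₂ T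
  have hst₂ : IsStationary (target f₂ g₂) (kernel T f₂ g₂) := hDB₂.isStationary hK₂row.2
  have hπ₂1 : ∑ z : X × Ξ₂, target f₂ g₂ z = 1 := by rw [sum_target_univ hunb₂, hπ1]
  have hZ₂ := isUnit_fundamentalInv hπ₂1 hK₂row hst₂ hirr₂
  have hmart : ∀ x ξ₁, ∑ ξ₂, r x ξ₁ ξ₂ * f₂ x ξ₂ = g₁ ξ₁ * f₁ x ξ₁ :=
    fun x ξ₁ => IsMartingaleCoupling.sum_mul_est (hπ x) (hR x) ξ₁
  -- the centred observable and its two lifts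
  have huc : ∑ x, π x * centred π u x = 0 := sum_mul_centred hπ1 u
  have hlift₁ : centred (target f₁ g₁) (lift u : X × Ξ₁ → ℝ) = lift (centred π u) :=
    centred_lift hunb₁ u
  have hlift₂ : centred (target f₂ g₂) (lift u : X × Ξ₂ → ℝ) = lift (centred π u) :=
    centred_lift hunb₂ u
  have huc₁ : ∑ z : X × Ξ₁, target f₁ g₁ z * (lift (centred π u) : X × Ξ₁ → ℝ) z = 0 := by
    rw [sum_target_mul_lift hunb₁, huc]
  have huc₂ : ∑ z : X × Ξ₂, target f₂ g₂ z * (lift (centred π u) : X × Ξ₂ → ℝ) z = 0 := by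
    rw [sum_target_mul_lift hunb₂, huc]
  -- the two variances in centred form
  have e1 := asympVar_eq_centred hπ₁1 hK₁row hst₁ hZ₁ (lift u : X × Ξ₁ → ℝ)
  rw [hlift₁] at e1
  have e2 := asympVar_eq_centred hπ₂1 hK₂row hst₂ hZ₂ (lift u : X × Ξ₂ → ℝ)
  rw [hlift₂] at e2
  -- equal stationary variances
  have e3 : piInner (target f₁ g₁) (lift (centred π u) : X × Ξ₁ → ℝ) (lift (centred π u)) =
      piInner π (centred π u) (centred π u) := piInner_lift hunb₁ _ _
  have e3' : piInner (target f₂ g₂) (lift (centred π u) : X × Ξ₂ → ℝ) (lift (centred π u)) =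
      piInner π (centred π u) (centred π u) := piInner_lift hunb₂ _ _
  -- transport of the chain-1 Poisson solution: `⟨f̄, w⟩₂ = ⟨f̄, h₁⟩₁`
  have e4 := piInner_lift_condAvg hg₂ hmart (centred π u)
    (fundamentalMatrix (target f₁ g₁) (kernel T f₁ g₁) *ᵥ (lift (centred π u) : X × Ξ₁ → ℝ))
  -- the variational identity of chain 2 at the test function `w`
  have e5 := variational_identity hπ₂1 hK₂row hDB₂ hZ₂ huc₂
    (condAvg r g₂ (fundamentalMatrix (target f₁ g₁) (kernel T f₁ g₁) *ᵥ
      (lift (centred π u) : X × Ξ₁ → ℝ)))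
  -- `𝓔₁(h₁) = ⟨f̄, h₁⟩₁`
  have e6 := dirichletForm_fundamentalMatrix_mulVec hπ₁1 hK₁row hst₁ hZ₁ huc₁
  linarith [e1, e2, e3, e3', e4, e5, e6]

/-- **ANDRIEU–VIHOLA 2016, THEOREM 10 (c)** (finite form, under a martingale coupling of the weights):
"let `P̃₁` and `P̃₂` be two pseudo-marginal approximations of `P` aiming to sample from `π`, sharing
a common family of marginal proposal probability distributions `{q(x, ·)}` but with distinct weight
distributions satisfying `{Q_x^{(1)}} ≤cx {Q_x^{(2)}}`.  Then … (c) for any `f : X → ℝ` with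
`var_π(f) < ∞`, the asymptotic variances satisfy `var(f, P̃₁) ≤ var(f, P̃₂)`."  Here the convex order
is witnessed by a martingale coupling `r x` of the normalised weights at every state (printed Lemma
18; `IsMartingaleCoupling.isCxLE`), both estimators are positive and unbiased for the probability
vector `π`, `T ≥ 0` has row sums `≤ 1`, and both chains are irreducible.
[cite: AndrieuVihola2016, Theorem 10 (c); §5 (proof via Lemma 18, Lemma 20, Corollary 21,
Theorem 22)] -/
theorem asympVar_lift_mono_of_coupling {f₁ : X → Ξ₁ → ℝ} {g₁ : Ξ₁ → ℝ}
    {f₂ : X → Ξ₂ → ℝ} {g₂ : Ξ₂ → ℝ} {π : X → ℝ} {T : X → X → ℝ} {r : X → Ξ₁ → Ξ₂ → ℝ}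
    (hf₁ : ∀ x ξ, 0 < f₁ x ξ) (hg₁ : ∀ ξ, 0 < g₁ ξ) (hg₁1 : ∑ ξ, g₁ ξ = 1)
    (hunb₁ : ∀ x, ∑ ξ, g₁ ξ * f₁ x ξ = π x)
    (hf₂ : ∀ x ξ, 0 < f₂ x ξ) (hg₂ : ∀ ξ, 0 < g₂ ξ) (hg₂1 : ∑ ξ, g₂ ξ = 1)
    (hunb₂ : ∀ x, ∑ ξ, g₂ ξ * f₂ x ξ = π x) (hπ : ∀ x, 0 < π x) (hπ1 : ∑ x, π x = 1)
    (hT : ∀ x y, 0 ≤ T x y) (hTrow : ∀ x, ∑ y, T x y ≤ 1)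
    (hR : ∀ x, IsMartingaleCoupling g₁ (fun ξ => f₁ x ξ / π x) g₂ (fun ξ => f₂ x ξ / π x) (r x))
    (hirr₁ : IsIrreducible (kernel T f₁ g₁ : Matrix (X × Ξ₁) (X × Ξ₁) ℝ))
    (hirr₂ : IsIrreducible (kernel T f₂ g₂ : Matrix (X × Ξ₂) (X × Ξ₂) ℝ)) (u : X → ℝ) :
    asympVar (lift u : X × Ξ₁ → ℝ) (target f₁ g₁) (kernel T f₁ g₁) ≤
      asympVar (lift u : X × Ξ₂ → ℝ) (target f₂ g₂) (kernel T f₂ g₂) := by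
  have hid := asympVar_sub_asympVar_eq_of_coupling hf₁ hg₁ hg₁1 hunb₁ hf₂ hg₂ hg₂1 hunb₂ hπ hπ1
    hT hTrow hR hirr₁ hirr₂ u
  have h1 := dirichletForm_condAvg_le hf₁ hg₁ hf₂ hg₂ hπ hR T hT
    (fundamentalMatrix (target f₁ g₁) (kernel T f₁ g₁) *ᵥ (lift (centred π u) : X × Ξ₁ → ℝ))
  have h2 : 0 ≤ dirichletForm (target f₂ g₂) (kernel T f₂ g₂)
      (fundamentalMatrix (target f₂ g₂) (kernel T f₂ g₂) *ᵥ (lift (centred π u) : X × Ξ₂ → ℝ)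
        - condAvg r g₂ (fundamentalMatrix (target f₁ g₁) (kernel T f₁ g₁) *ᵥ
            (lift (centred π u) : X × Ξ₁ → ℝ))) :=
    dirichletForm_nonneg (fun z => (target_pos₂ hf₂ hg₂ z).le)
      (kernel_isRowStochastic hf₂ hg₂ hg₂1 hT hTrow).1 _
  refine sub_nonneg.mp ?_
  rw [hid]
  exact add_nonneg (mul_nonneg zero_le_two (sub_nonneg.mpr h1)) (mul_nonneg zero_le_two h2)

end Coupling

/-! ## Averaging one more independent draw: the leave-one-out coupling -/

section Averaging

/-- The LEAVE-ONE-OUT COUPLING of `M + 2` i.i.d. draws with `M + 1` i.i.d. draws: draw the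
`(M+2)`-tuple `ζ` from the product law and delete a uniformly chosen coordinate —
`r ζ ζ' = Π_i g(ζ_i) · #{j : ζ without j = ζ'} / (M + 2)`.  Its martingale property is the
leave-one-out identity `W̄_{M+2} = (1/(M+2)) Σ_j W̄_{M+1}^{(−j)}` of exchangeable copies.
[cite: AndrieuVihola2016, §6.1 Theorem 28 (proof: "`(λ, Z) ≤cx (μ, Z)` for `λ ≺ μ`", exchangeable
`W₁, …, W_N`) and Theorem 31 (uniform weights `u_{k+1} ≺ u_k`)] -/
noncomputable def looCoupling (g : Ξ → ℝ) (M : ℕ) (ζ : Fin (M + 2) → Ξ) (ζ' : Fin (M + 1) → Ξ) : ℝ :=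
  (∑ j : Fin (M + 2), if Fin.removeNth j ζ = ζ' then piLaw g (M + 2) ζ else 0) / ((M + 2 : ℕ) : ℝ)

omit [Fintype X] [DecidableEq X] [DecidableEq Ξ] in
/-- Re-indexing a sum over `(N+1)`-tuples by separating out the `j`-th draw (private helper).
[folklore] -/
private theorem sum_tuple_insertNth' {A : Type*} [AddCommMonoid A] {N : ℕ} (j : Fin (N + 1))
    (H : (Fin (N + 1) → Ξ) → A) :
    ∑ ζ, H ζ = ∑ a, ∑ ζ' : Fin N → Ξ, H (Fin.insertNth j a ζ') := by
  rw [← Fintype.sum_prod_type']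
  exact (Fintype.sum_equiv (Fin.insertNthEquiv (fun _ => Ξ) j) _ _ fun q => rfl).symm

omit [Fintype X] [DecidableEq X] [Fintype Ξ] [DecidableEq Ξ] in
/-- The product law factorises over the separated draw (private helper). [folklore] -/
private theorem piLaw_insertNth' (g : Ξ → ℝ) {N : ℕ} (j : Fin (N + 1)) (a : Ξ)
    (ζ' : Fin N → Ξ) : piLaw g (N + 1) (Fin.insertNth j a ζ') = g a * piLaw g N ζ' := by
  simp only [piLaw]
  rw [Fin.prod_univ_succAbove _ j, Fin.insertNth_apply_same]
  congr 1
  exact prod_congr rfl fun i _ => by rw [Fin.insertNth_apply_succAbove]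

omit [Fintype X] [DecidableEq X] [DecidableEq Ξ] in
/-- Marginalising the separated draw: `Σ_ζ Π g(ζ_i) F(ζ without j) = (Σ g) Σ_{ζ'} Π g(ζ'_i) F(ζ')`
(private helper). [folklore] -/
private theorem sum_piLaw_mul_removeNth' (g : Ξ → ℝ) {N : ℕ} (j : Fin (N + 1))
    (F : (Fin N → Ξ) → ℝ) :
    ∑ ζ, piLaw g (N + 1) ζ * F (Fin.removeNth j ζ) =
      (∑ a, g a) * ∑ ζ' : Fin N → Ξ, piLaw g N ζ' * F ζ' := by
  rw [sum_tuple_insertNth' j, sum_mul]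
  refine sum_congr rfl fun a _ => ?_
  rw [mul_sum]
  refine sum_congr rfl fun ζ' _ => ?_
  rw [piLaw_insertNth', Fin.removeNth_insertNth, mul_assoc]

omit [Fintype X] [DecidableEq X] [Fintype Ξ] [DecidableEq Ξ] in
/-- The leave-one-out identity for sums: `Σ_j Σ_i v(j.succAbove i) = (M+1) Σ_k v k` over
`j : Fin (M+2)` (private helper). [folklore] -/
private theorem sum_sum_succAbove' {M : ℕ} (v : Fin (M + 2) → ℝ) :
    ∑ j : Fin (M + 2), ∑ i : Fin (M + 1), v (j.succAbove i) = (M + 1) * ∑ k, v k := by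
  have h : ∀ j : Fin (M + 2), ∑ i : Fin (M + 1), v (j.succAbove i) = ∑ k, v k - v j := by
    intro j
    rw [Fin.sum_univ_succAbove v j]
    ring
  simp_rw [h, sum_sub_distrib, sum_const, card_univ, Fintype.card_fin, nsmul_eq_mul]
  push_cast
  ring

omit [Fintype X] [DecidableEq X] [Fintype Ξ] [DecidableEq Ξ] in
/-- The leave-one-out identity for the averaged estimator:
`(1/(M+2)) Σ_j avgEst f (M+1) x (ζ without j) = avgEst f (M+2) x ζ` (private helper). [folklore] -/
private theorem avgEst_loo (f : X → Ξ → ℝ) (M : ℕ) (x : X) (ζ : Fin (M + 2) → Ξ) :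
    (∑ j : Fin (M + 2), avgEst f (M + 1) x (Fin.removeNth j ζ)) / ((M + 2 : ℕ) : ℝ) =
      avgEst f (M + 2) x ζ := by
  have h2 : ∑ j : Fin (M + 2), ∑ i : Fin (M + 1), f x (ζ (j.succAbove i)) = (M + 1) * ∑ k, f x (ζ k) :=
    sum_sum_succAbove' fun k => f x (ζ k)
  have hM1 : ((M + 1 : ℕ) : ℝ) ≠ 0 := Nat.cast_ne_zero.mpr (Nat.succ_ne_zero M)
  have hM2 : ((M + 2 : ℕ) : ℝ) ≠ 0 := Nat.cast_ne_zero.mpr (Nat.succ_ne_zero (M + 1))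
  simp only [avgEst, Fin.removeNth]
  rw [← sum_div, h2]
  push_cast at hM1 hM2 ⊢
  field_simp

omit [Fintype X] [DecidableEq X] in
/-- **The leave-one-out coupling is a martingale coupling** of the `(M+2)`-draw averaged estimator
(law `piLaw g (M+2)`, the LESS noisy one) with the `(M+1)`-draw averaged estimator (law
`piLaw g (M+1)`), at every state `x` (normalised weights `avgEst f N x · / π x`), for a probability
vector `g`. [cite: AndrieuVihola2016, §6.1 Theorem 28 (exchangeable copies and majorised weights are
convex-ordered through a martingale construction) and Theorem 31 (`u_{k+1} ≺ u_k`)] -/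
theorem looCoupling_isMartingaleCoupling {g : Ξ → ℝ} (hg : ∀ ξ, 0 ≤ g ξ) (hg1 : ∑ ξ, g ξ = 1)
    (f : X → Ξ → ℝ) (π : X → ℝ) (M : ℕ) (x : X) :
    IsMartingaleCoupling (piLaw g (M + 2)) (fun ζ => avgEst f (M + 2) x ζ / π x)
      (piLaw g (M + 1)) (fun ζ' => avgEst f (M + 1) x ζ' / π x) (looCoupling g M) := by
  have hM2 : ((M + 2 : ℕ) : ℝ) ≠ 0 := Nat.cast_ne_zero.mpr (Nat.succ_ne_zero (M + 1))
  have hM2pos : (0 : ℝ) < ((M + 2 : ℕ) : ℝ) := Nat.cast_pos.mpr (Nat.succ_pos (M + 1))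
  have hpi : ∀ N (ζ : Fin N → Ξ), 0 ≤ piLaw g N ζ := fun N ζ => prod_nonneg fun i _ => hg (ζ i)
  refine ⟨fun ζ ζ' => ?_, fun ζ => ?_, fun ζ' => ?_, fun ζ => ?_⟩
  · -- non-negativity
    exact div_nonneg (sum_nonneg fun j _ => by split_ifs <;> [exact hpi _ ζ; exact le_rfl]) hM2pos.le
  · -- first marginal: summing out the shorter tuple
    simp only [looCoupling]
    rw [← sum_div, sum_comm]
    simp_rw [sum_ite_eq, if_pos (mem_univ _)]
    rw [sum_const, card_univ, Fintype.card_fin, nsmul_eq_mul, mul_div_cancel_left₀ _ hM2]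
  · -- second marginal: summing out the longer tuple, coordinate by coordinate
    simp only [looCoupling]
    rw [← sum_div, sum_comm]
    have h : ∀ j : Fin (M + 2), ∑ ζ : Fin (M + 2) → Ξ,
        (if Fin.removeNth j ζ = ζ' then piLaw g (M + 2) ζ else 0) = piLaw g (M + 1) ζ' := by
      intro j
      have e : ∀ ζ : Fin (M + 2) → Ξ, (if Fin.removeNth j ζ = ζ' then piLaw g (M + 2) ζ else 0) =
          piLaw g (M + 2) ζ * (if Fin.removeNth j ζ = ζ' then 1 else 0) := fun ζ => by
        split_ifs <;> simp
      simp_rw [e]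
      rw [sum_piLaw_mul_removeNth' g j (fun ζ'' => if ζ'' = ζ' then (1 : ℝ) else 0), hg1, one_mul]
      simp_rw [mul_ite, mul_one, mul_zero]
      rw [sum_ite_eq' univ ζ', if_pos (mem_univ _)]
    simp_rw [h]
    rw [sum_const, card_univ, Fintype.card_fin, nsmul_eq_mul, mul_div_cancel_left₀ _ hM2]
  · -- martingale property: the leave-one-out identity
    simp only [looCoupling]
    have e : ∀ ζ' : Fin (M + 1) → Ξ,
        (∑ j : Fin (M + 2), if Fin.removeNth j ζ = ζ' then piLaw g (M + 2) ζ else 0) /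
            ((M + 2 : ℕ) : ℝ) * (avgEst f (M + 1) x ζ' / π x) =
          ∑ j : Fin (M + 2), (if Fin.removeNth j ζ = ζ' then
            piLaw g (M + 2) ζ * (avgEst f (M + 1) x ζ' / π x) / ((M + 2 : ℕ) : ℝ) else 0) := by
      intro ζ'
      rw [div_mul_eq_mul_div, sum_mul, sum_div]
      refine sum_congr rfl fun j _ => ?_
      split_ifs <;> simp
    simp_rw [e]
    rw [sum_comm]
    simp_rw [sum_ite_eq, if_pos (mem_univ _)]
    rw [← avgEst_loo f M x ζ]
    simp_rw [div_div, ← sum_div]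
    rw [sum_div, sum_div, mul_sum]
    refine sum_congr rfl fun j _ => ?_
    field_simp

omit [Fintype Ξ] [DecidableEq Ξ] in
/-- The product law is positive when `g` is (private helper). [folklore] -/
private theorem piLaw_pos' {g : Ξ → ℝ} (hg : ∀ ξ, 0 < g ξ) (N : ℕ) (ζ : Fin N → Ξ) :
    0 < piLaw g N ζ :=
  prod_pos fun i _ => hg (ζ i)

omit [Fintype X] [DecidableEq X] [Fintype Ξ] [DecidableEq Ξ] in
/-- The averaged estimator over at least one draw is positive when `f` is (private helper).
[folklore] -/
private theorem avgEst_pos' {f : X → Ξ → ℝ} (hf : ∀ x ξ, 0 < f x ξ) (N : ℕ) [NeZero N] (x : X)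
    (ζ : Fin N → Ξ) : 0 < avgEst f N x ζ :=
  div_pos (sum_pos (fun i _ => hf x (ζ i)) univ_nonempty) (Nat.cast_pos.mpr (Nat.pos_of_neZero N))

omit [DecidableEq Ξ] in
/-- The product law is a probability vector when `g` is (private helper). [folklore] -/
private theorem sum_piLaw_eq_one {g : Ξ → ℝ} (hg1 : ∑ ξ, g ξ = 1) (N : ℕ) :
    ∑ ζ, piLaw g N ζ = 1 := by
  rw [sum_piLaw, hg1, one_pow]

/-- **Every extra independent draw lowers the asymptotic variance** (Theorem 31 with Theorem 10 (c),
finite form, i.i.d. draws and uniform weights): with the same proposal matrix `T` and the same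
per-draw positive unbiased estimator `f` (noise law `g`), the pseudo-marginal chain that averages
`M + 2` draws has, for EVERY observable `u` of the state, asymptotic variance at most that of the
chain averaging `M + 1` draws — "`i ↦ var(f, P̃_i)` is non-increasing" for "a number of estimators
combined by averaging"; the integrated-autocorrelation analogue of `ESS(N_pf)` increasing in the
number `N_pf` of pseudofermion draws.  Both chains are assumed irreducible.
[cite: AndrieuVihola2016, §6.1 Theorem 31 ("every extra sample improves performance") with
Remark 15 and Theorem 10 (c)]; [cite: AbbottEtAl2022Fermions, §III.E (the `N_pf`-draw weight
`w_{N_pf}` and `ESS(N_pf)`)] -/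
theorem asympVar_avgEst_succ_le {f : X → Ξ → ℝ} {g : Ξ → ℝ} {π : X → ℝ} {T : X → X → ℝ}
    (hf : ∀ x ξ, 0 < f x ξ) (hg : ∀ ξ, 0 < g ξ) (hg1 : ∑ ξ, g ξ = 1)
    (hunb : ∀ x, ∑ ξ, g ξ * f x ξ = π x) (hπ : ∀ x, 0 < π x) (hπ1 : ∑ x, π x = 1)
    (hT : ∀ x y, 0 ≤ T x y) (hTrow : ∀ x, ∑ y, T x y ≤ 1) (M : ℕ)
    (hirr₁ : IsIrreducible (kernel T (avgEst f (M + 2)) (piLaw g (M + 2)) :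
      Matrix (X × (Fin (M + 2) → Ξ)) (X × (Fin (M + 2) → Ξ)) ℝ))
    (hirr₂ : IsIrreducible (kernel T (avgEst f (M + 1)) (piLaw g (M + 1)) :
      Matrix (X × (Fin (M + 1) → Ξ)) (X × (Fin (M + 1) → Ξ)) ℝ))
    (u : X → ℝ) :
    asympVar (lift u : X × (Fin (M + 2) → Ξ) → ℝ) (target (avgEst f (M + 2)) (piLaw g (M + 2)))
        (kernel T (avgEst f (M + 2)) (piLaw g (M + 2))) ≤
      asympVar (lift u : X × (Fin (M + 1) → Ξ) → ℝ) (target (avgEst f (M + 1)) (piLaw g (M + 1)))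
        (kernel T (avgEst f (M + 1)) (piLaw g (M + 1))) :=
  asympVar_lift_mono_of_coupling (fun x ζ => avgEst_pos' hf (M + 2) x ζ) (piLaw_pos' hg (M + 2))
    (sum_piLaw_eq_one hg1 (M + 2)) (sum_piLaw_mul_avgEst hg1 hunb (M + 2))
    (fun x ζ => avgEst_pos' hf (M + 1) x ζ) (piLaw_pos' hg (M + 1)) (sum_piLaw_eq_one hg1 (M + 1))
    (sum_piLaw_mul_avgEst hg1 hunb (M + 1)) hπ hπ1 hT hTrow
    (fun x => looCoupling_isMartingaleCoupling (fun ξ => (hg ξ).le) hg1 f π M x) hirr₁ hirr₂ u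

end Averaging

/-! ## Strassen's theorem: the convex order itself yields the coupling, and Theorem 10 (c) under
its printed hypothesis -/

section Strassen

variable {Ξ₁ Ξ₂ : Type*} [Fintype Ξ₁] [DecidableEq Ξ₁] [Fintype Ξ₂] [DecidableEq Ξ₂]

omit [Fintype X] [DecidableEq X] [Fintype Ξ] [DecidableEq Ξ] [DecidableEq Ξ₁] [DecidableEq Ξ₂] in
/-- **Strassen's theorem for two finitely supported weight laws** (the converse of
`IsMartingaleCoupling.isCxLE`): if `Q¹ ≤cx Q²` for non-negative weights `g₁`, `g₂`, then a
martingale coupling of `Q¹` and `Q²` EXISTS — "The following characterisation of the convex order,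
often referred to as Strassen's theorem, establishes the converse, that is that the convex order
implies the existence of this type of martingale representation".  This is the tree's finite
Strassen theorem `Literature.Probability.Distributions.exists_martingaleCoupling_of_convexOrder`
(Farkas' lemma on the coupling polytope, separated by the convex upper envelope of an affine
family), repackaged in the vocabulary of this file. [cite: AndrieuVihola2016, §2 Theorem 7
(constructive half)]; [cite: Strassen1965] -/
theorem IsCxLE.exists_isMartingaleCoupling {g₁ : Ξ₁ → ℝ} {w₁ : Ξ₁ → ℝ} {g₂ : Ξ₂ → ℝ}
    {w₂ : Ξ₂ → ℝ} (h : IsCxLE g₁ w₁ g₂ w₂) (hg₁ : ∀ ξ, 0 ≤ g₁ ξ) (hg₂ : ∀ ξ, 0 ≤ g₂ ξ) :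
    ∃ r : Ξ₁ → Ξ₂ → ℝ, IsMartingaleCoupling g₁ w₁ g₂ w₂ r := by
  obtain ⟨r, hr, hfst, hsnd, hmart⟩ :=
    Literature.Probability.Distributions.exists_martingaleCoupling_of_convexOrder hg₁ hg₂ h
  exact ⟨r, ⟨hr, hfst, hsnd, hmart⟩⟩

omit [Fintype X] [DecidableEq X] [Fintype Ξ] [DecidableEq Ξ] [DecidableEq Ξ₁] [DecidableEq Ξ₂] in
/-- **Strassen's theorem, both halves, for two finitely supported weight laws**: for non-negative
weights, `Q¹ ≤cx Q²` iff a martingale coupling of `Q¹` and `Q²` exists — "`W₁ ≤cx W₂` if and only if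
there exists a probability space with random variables `W̌₁` and `W̌₂` coinciding with `W₁` and `W₂`
in distribution respectively, such that `(W̌₁, W̌₂)` is a martingale pair, that is,
`E[W̌₂ | W̌₁] = W̌₁` (a.s.)".  (The easy half here is
`Literature.Probability.Distributions.sum_mul_le_sum_mul_of_martingaleCoupling`, which, unlike
`IsMartingaleCoupling.isCxLE`, does not need `g₁ > 0`.) [cite: AndrieuVihola2016, §2 Theorem 7];
[cite: Strassen1965] -/
theorem isCxLE_iff_exists_isMartingaleCoupling {g₁ : Ξ₁ → ℝ} (w₁ : Ξ₁ → ℝ) {g₂ : Ξ₂ → ℝ}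
    (w₂ : Ξ₂ → ℝ) (hg₁ : ∀ ξ, 0 ≤ g₁ ξ) (hg₂ : ∀ ξ, 0 ≤ g₂ ξ) :
    IsCxLE g₁ w₁ g₂ w₂ ↔ ∃ r : Ξ₁ → Ξ₂ → ℝ, IsMartingaleCoupling g₁ w₁ g₂ w₂ r := by
  refine ⟨fun h => h.exists_isMartingaleCoupling hg₁ hg₂, fun ⟨r, hr⟩ φ hφ => ?_⟩
  exact Literature.Probability.Distributions.sum_mul_le_sum_mul_of_martingaleCoupling hr.nonneg
    hr.fst hr.snd hr.mart hφ

/-- **Andrieu–Vihola 2016, Theorem 10 (c), finite form, under its PRINTED hypothesis — the convex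
order of the normalised weights at every state**: "let `P̃₁` and `P̃₂` be two pseudo-marginal
approximations of `P` aiming to sample from `π`, sharing a common family of marginal proposal
probability distributions `{q(x, ·)}` but with distinct weight distributions satisfying
`{Q_x^{(1)}} ≤cx {Q_x^{(2)}}`.  Then … (c) for any `f : X → ℝ` with `var_π(f) < ∞`, the asymptotic
variances satisfy `var(f, P̃₁) ≤ var(f, P̃₂)`."  Proof as printed: "let `x ∈ X` and let `R_x` be the
probability kernel from Theorem 18" — Strassen's theorem state by state
(`IsCxLE.exists_isMartingaleCoupling`; on a finite `X` the choice over `x` needs no measurability) —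
then `asympVar_lift_mono_of_coupling`.  Both estimators positive and unbiased for the probability
vector `π`, `T ≥ 0` with row sums `≤ 1`, both chains irreducible. [cite: AndrieuVihola2016,
Theorem 10 (c); §5 Lemma 18 and the proof of Theorem 10] -/
theorem asympVar_lift_mono_of_isCxLE {f₁ : X → Ξ₁ → ℝ} {g₁ : Ξ₁ → ℝ}
    {f₂ : X → Ξ₂ → ℝ} {g₂ : Ξ₂ → ℝ} {π : X → ℝ} {T : X → X → ℝ}
    (hf₁ : ∀ x ξ, 0 < f₁ x ξ) (hg₁ : ∀ ξ, 0 < g₁ ξ) (hg₁1 : ∑ ξ, g₁ ξ = 1)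
    (hunb₁ : ∀ x, ∑ ξ, g₁ ξ * f₁ x ξ = π x)
    (hf₂ : ∀ x ξ, 0 < f₂ x ξ) (hg₂ : ∀ ξ, 0 < g₂ ξ) (hg₂1 : ∑ ξ, g₂ ξ = 1)
    (hunb₂ : ∀ x, ∑ ξ, g₂ ξ * f₂ x ξ = π x) (hπ : ∀ x, 0 < π x) (hπ1 : ∑ x, π x = 1)
    (hT : ∀ x y, 0 ≤ T x y) (hTrow : ∀ x, ∑ y, T x y ≤ 1)
    (hcx : ∀ x, IsCxLE g₁ (fun ξ => f₁ x ξ / π x) g₂ (fun ξ => f₂ x ξ / π x))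
    (hirr₁ : IsIrreducible (kernel T f₁ g₁ : Matrix (X × Ξ₁) (X × Ξ₁) ℝ))
    (hirr₂ : IsIrreducible (kernel T f₂ g₂ : Matrix (X × Ξ₂) (X × Ξ₂) ℝ)) (u : X → ℝ) :
    asympVar (lift u : X × Ξ₁ → ℝ) (target f₁ g₁) (kernel T f₁ g₁) ≤
      asympVar (lift u : X × Ξ₂ → ℝ) (target f₂ g₂) (kernel T f₂ g₂) := by
  choose r hr using fun x =>
    (hcx x).exists_isMartingaleCoupling (fun ξ => (hg₁ ξ).le) (fun ξ => (hg₂ ξ).le)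
  exact asympVar_lift_mono_of_coupling hf₁ hg₁ hg₁1 hunb₁ hf₂ hg₂ hg₂1 hunb₂ hπ hπ1 hT hTrow hr
    hirr₁ hirr₂ u

end Strassen

end PseudoMarginal

end Literature.Probability.MarkovChains
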